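import Summits.BirchSwinnertonDyer.BirchSwinnertonDyer.Theses.ResidualThetaTransportAtTwo
import Summits.BirchSwinnertonDyer.BirchSwinnertonDyer.Theorems.ResidualThetaTransportAtTwoResidualThetaMainConjectureAtTwoLowerCount
import Summits.BirchSwinnertonDyer.BirchSwinnertonDyer.Theorems.ThetaPartnerAtTwoSignedTransportAtTwoRlfLambdaOfPrint
import Summits.BirchSwinnertonDyer.BirchSwinnertonDyer.Theorems.ThetaPartnerAtTwoSignedMainConjectureCMTwoRankZeroOfLocal
import HarnessLib

/-!
# Crux Kλ⁺ `ResidualThetaMainConjectureAtTwo` (stmt-BirchSwinnertonDyer-20787) and RTC≥ `ResidualThetaCountLowerAtTwo`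
# (stmt-BirchSwinnertonDyer-25435), route `ResidualThetaTransportAtTwo`: the uniform-family residual λ-formula
# RLF (stmt-BirchSwinnertonDyer-23110) is NOT needed — the count of `W` itself is PRINT at analytic rank `0`

Cell `bsd-wall`, seat `bsd-wall-rtt-p2` g8 (LEAD PROVER on the RMC/RTC≥ line; `--supports`; closes nothing). THEOREMS ONLY — no
`def`, no named fact introduced, no `sorry`; every research input is an explicit hypothesis BY NAME (a route decl) or spelled out;
nothing about any curve is asserted and BSD is not proved by any of this.

THE POINT (kernel-exact). The landed closer `residualThetaMainConjectureAtTwo_of_lowerCount` (p593028) reads Kλ⁺ ⟸ RLF (23110) ∧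
RTC≥ (25435) ∧ K3 ∧ Kan⁺, and inside it RLF is used for exactly two things: (i) the count of the habitat curve `W` itself,
`#R⁺_{S₀}(W[2]) = 2^(λ(X⁺_W) + Σ_W + c)`, and (ii) to discharge the uniform-family premise `P(c)` of RTC≥. But `W` has analytic
rank `0`, so `Sel_{2^∞}(W/ℚ)` is finite (Gross–Zagier–Kolyvagin = route item `RankEqAnalyticRankLeOne`, 19921), and then (i) WITH
`c = 0` is the landed print road of route TPT (`SignedTransportAtTwo.rlf2_of_print4`, tp2-p1 g8, p599769) modulo the four printed
Greenberg facts = conjuncts 1, 2, 3, 5 of route item `PublishedInputsGreenbergControlAtTwo` (24143). The uniform-family statement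
23110 — quantifying over curves of EVERY rank, where Greenberg–Vatsal's Prop. (2.1) / B. D. Kim's no-finite-submodule theorem for the
signed Selmer group at `2` are unprinted and not in the tree — enters only through the SHAPE of RTC≥'s premise.

Write (R≥) for RTC≥ with that premise deleted and `c := 0`:
«on the habitat⁺, for every CM partner datum `(M, g, ι)` at a cohomological plus period `Ω`, congruent to `W` off `2·M·N_W`,
cyclotomic `(κ, γ)`, admissible odd `S₀ ⊇ bad(W) ∪ primes(M)`, torsion `μ = 0` signed `+` dual datum `D` of `W`, every
`𝓞`-Pollack pair `(L⁺, L⁻)` of `g` at `Ω` with norm-λ `d` of `L⁻`: `2^(d + Σ_{v ∈ S₀} 2^{n_ℓ} d_{g,ℓ}) ≤ #R⁺_{S₀}(W[2])`» —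
the route thesis in its own words (the ONE residual object `R⁺_{S₀}(W[2]) = R⁺_{S₀}(ρ̄_g)` has at least as many classes as the
`S₀`-imprimitive analytic λ of the CM partner predicts: main-conjecture EQUALITY for `g = θ_φ` at the inert prime `2`, read
residually). This file proves, all BY NAME over route decls:

* `residualThetaMainConjectureAtTwo_of_residualLower` : PUB-G (24143) → GZK (19921) → (R≥) → K3 (20308) → Kan⁺ (20688) → Kλ⁺ (20787);
* `residualThetaCountLowerAtTwo_of_residualLower` : PUB-G → GZK → (R≥) → RTC≥ (25435);
* `residualLower_of_residualLambdaFormula_of_countLower` : RLF (23110) → RTC≥ (25435) → (R≥).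

So (R≥) is implied by the current pair {23110, 25435} and, together with the route's own PUB binders `hPubG`/`hGZK` of `closes`,
implies everything that pair is used for: a route keyed on (R≥) instead of {23110, 25435} no longer waits on the positive-rank
residual λ-formula at `2`. The research content is unchanged and is exactly (R≥).

References: [GreenbergVatsal2000] §2 Prop. (2.1), (2.4), (2.8), (10); [BDKim2013] Thm. 1.1; [GreenbergLNM1716] Props. 4.12–4.15;
[Kolyvagin1990] Thm. A; [GrossZagier1986] Thm. I.6.3; [Kobayashi2003] Thm. 1.2/1.3; [Kato2004] Thm. 17.4; [PollackWeston2011MT] §3–4.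
-/

set_option autoImplicit false
-- D-0017: single-problem summit, so `Summit.BirchSwinnertonDyer.BirchSwinnertonDyer.…` repeats a namespace BY DESIGN.
set_option linter.dupNamespace false

noncomputable section

open scoped Classical

namespace Summit.BirchSwinnertonDyer.BirchSwinnertonDyer.Theorems.ResidualThetaLayer

/-- **Kλ⁺ BY NAME from PUB-G, GZK, the pure residual lower bound (R≥), K3 and Kan⁺ — no RLF.** For the crux's data take a
cohomological plus period `Ω'` of `g` along `ι` (22892, landed), the landed `𝓞`-Pollack pair of `g` at `Ω'` and the norm-λ `d` of
`L⁻_g`; `Sel_{2^∞}(W/ℚ)` is finite (GZK at analytic rank `0`), so the print road gives `#R⁺_{S₀}(W[2]) = 2^(λ(X) + Σ_W)`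
(`SignedTransportAtTwo.rlf2_of_print4` modulo conjuncts 1,2,3,5 of PUB-G); (R≥) gives `2^(d + Σ_g) ≤ #R⁺_{S₀}(W[2])`, hence
`d + Σ_g ≤ λ(X) + Σ_W`; Kan⁺ at `Ω'` with the two landed layer laws gives `λ(G) + Σ_W = d + Σ_g`; K3 gives `λ(X) ≤ λ(G)`; so
`λ(X) = λ(G)` and both sides of Kλ⁺'s defect identity vanish at every Kan⁺-layer for `Ω`.
[cite: GreenbergVatsal2000, Prop. 2.8 and (10)] [cite: PollackWeston2011MT, §3–4] [cite: Kato2004, Thm. 17.4] -/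
theorem residualThetaMainConjectureAtTwo_of_residualLower
    (hPubG : Summit.BirchSwinnertonDyer.BirchSwinnertonDyer.Theses.ResidualThetaTransportAtTwo.PublishedInputsGreenbergControlAtTwo)
    (hGZK : Summit.BirchSwinnertonDyer.BirchSwinnertonDyer.Theses.ResidualThetaTransportAtTwo.RankEqAnalyticRankLeOne)
    (hRge : ∀ (W : WeierstrassCurve ℚ) [W.IsElliptic] [W.IsGloballyMinimal], ¬ W.HasCM → W.analyticRank = 0 → Literature.NumberTheory.EllipticCurves.Rank1Residual.GoodSS W 2 → W.frobeniusTrace 2 = 0 → W.Δ < 0 → ∀ (M : ℕ) [NeZero M] (g : CuspForm (CongruenceSubgroup.Gamma0 M) 2) (ι : Literature.NumberTheory.EllipticCurves.ModularForms.coeffField g →+* PadicAlgCl 2) (Ω : ℂ), Odd M → Literature.NumberTheory.EllipticCurves.ModularForms.IsNewform0 g → Literature.NumberTheory.Automorphic.IsCMForm (Literature.NumberTheory.EllipticCurves.ModularForms.liftToGamma1 M 2 g) → Literature.NumberTheory.EllipticCurves.ModularForms.cuspCoeff g 2 = 0 → Literature.NumberTheory.EllipticCurves.IsCohomologicalPlusPeriod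 g ι Ω → (∀ ℓ : ℕ, ℓ.Prime → ¬ ℓ ∣ 2 * M * W.conductorNorm ℤ → ‖Literature.NumberTheory.EllipticCurves.embCoeff g ι ℓ - (W.frobeniusTrace ℓ : PadicAlgCl 2)‖ < 1) → ∀ (κ : Literature.NumberTheory.EllipticCurves.ZpExtension ℚ 2) (γ : Field.absoluteGaloisGroup ℚ), κ.IsCyclotomic → κ.IsTopGenerator γ → Literature.NumberTheory.EllipticCurves.IsCyclotomicVariable 2 γ → ∀ (S₀ : Finset (IsDedekindDomain.HeightOneSpectrum (NumberField.RingOfIntegers ℚ))), (∀ v ∈ S₀, ((2 : ℕ) : NumberField.RingOfIntegers ℚ) ∉ v.asIdeal) → (∀ v : IsDedekindDomain.HeightOneSpectrum (NumberField.RingOfIntegers ℚ), ¬ W.HasGoodReductionAt v → v ∈ S₀) → (∀ v : IsDedekindDomain.HeightOneSpectrum (NumberField.RingOfIntegers ℚ), Rat.HeightOneSpectrum.natGenerator v ∣ M → v ∈ S₀) → ∀ (D : Literature.NumberTheory.EllipticCurves.Kobayashi2003.SignedSelmerDualData W κ γ 1) [Module.Finite (Literature.NumberTheory.EllipticCurves.IwasawaAlgebra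 2) D.X], Module.IsTorsion (Literature.NumberTheory.EllipticCurves.IwasawaAlgebra 2) D.X → D.mu = 0 → ∀ (Lp Lm : Literature.NumberTheory.EllipticCurves.IwasawaAlgebraO (Set.range ι)) (d : ℕ), Literature.NumberTheory.EllipticCurves.IsPollackPairK g ι Ω Lp Lm → (∀ k : ℕ, ‖PowerSeries.coeff k (Literature.NumberTheory.EllipticCurves.iwasawaOToPowerSeries (Set.range ι) Lm)‖ ≤ ‖PowerSeries.coeff d (Literature.NumberTheory.EllipticCurves.iwasawaOToPowerSeries (Set.range ι) Lm)‖) → (∀ k : ℕ, k < d → ‖PowerSeries.coeff k (Literature.NumberTheory.EllipticCurves.iwasawaOToPowerSeries (Set.range ι) Lm)‖ < ‖PowerSeries.coeff d (Literature.NumberTheory.EllipticCurves.iwasawaOToPowerSeries (Set.range ι) Lm)‖) → 2 ^ (d + (∑ v ∈ S₀, 2 ^ padicValNat 2 ((Rat.HeightOneSpectrum.natGenerator v ^ 2 - 1) / 8) * (if Rat.HeightOneSpectrum.natGenerator v ∣ M then (if ‖Literature.NumberTheory.EllipticCurves.embCoeff g ι (Rat.HeightOneSpectrum.natGenerator v)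 - 1‖ < 1 then 1 else 0) else (if ‖Literature.NumberTheory.EllipticCurves.embCoeff g ι (Rat.HeightOneSpectrum.natGenerator v)‖ < 1 then 2 else 0)))) ≤ {x : Literature.NumberTheory.EllipticCurves.subgroupH1 κ.kerSubgroup ↥(AddSubgroup.torsionBy ↥(W.geomPrimaryTorsion 2) (2 : ℤ)) | x ∈ Literature.NumberTheory.EllipticCurves.GreenbergVatsal2000.unramifiedOutside κ.kerSubgroup ↥(AddSubgroup.torsionBy ↥(W.geomPrimaryTorsion 2) (2 : ℤ)) 2 (↑S₀ : Set (IsDedekindDomain.HeightOneSpectrum (NumberField.RingOfIntegers ℚ))) ∧ (∀ (w : NumberField.InfinitePlace ℚ) (σ : Field.absoluteGaloisGroup ℚ), Literature.NumberTheory.EllipticCurves.conjH1 κ.kerSubgroup ↥(AddSubgroup.torsionBy ↥(W.geomPrimaryTorsion 2) (2 : ℤ)) σ x ∈ Literature.NumberTheory.EllipticCurves.GreenbergSelmer.infKer κ.kerSubgroup ↥(AddSubgroup.torsionBy ↥(W.geomPrimaryTorsion 2) (2 : ℤ)) w) ∧ (∀ (v : IsDedekindDomain.HeightOneSpectrum (NumberField.RingOfIntegers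 ℚ)), ((2 : ℕ) : NumberField.RingOfIntegers ℚ) ∈ v.asIdeal → ∀ σ : Field.absoluteGaloisGroup ℚ, W.conjH1 2 κ.kerSubgroup σ (Literature.NumberTheory.EllipticCurves.GreenbergVatsal2000.pushH1 κ.kerSubgroup (AddSubgroup.torsionBy ↥(W.geomPrimaryTorsion 2) (2 : ℤ)).subtype (fun _ _ ↦ rfl) x) ∈ Literature.NumberTheory.EllipticCurves.Kobayashi2003.localKummerOverOfEmb W 2 κ.kerSubgroup (Literature.NumberTheory.EllipticCurves.closureEmb (K := ℚ) (v.adicCompletion ℚ)) (⨆ n : ℕ, Literature.NumberTheory.EllipticCurves.Kobayashi2003.signedLocalPoints κ (v.adicCompletion ℚ) W 1 n))}.ncard)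
    (hKato : Summit.BirchSwinnertonDyer.BirchSwinnertonDyer.Theses.ResidualThetaTransportAtTwo.SignedKatoDivisibilityUpToAtTwo)
    (han : Summit.BirchSwinnertonDyer.BirchSwinnertonDyer.Theses.ResidualThetaTransportAtTwo.ThetaLayerLambdaCongruenceAtTwo) :
    Summit.BirchSwinnertonDyer.BirchSwinnertonDyer.Theses.ResidualThetaTransportAtTwo.ResidualThetaMainConjectureAtTwo := by
  intro W _ _ hcm hr hss ha hΔ M _ g ι Ω hodd hnew hcmg ha2 hΩ hcong κ γ hκ hγ hcv _ f hf ϖ hϖ Lplus Lminus hPP S₀ hS2 hSW hSM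
    D _ hX hμ G m hG
  -- it suffices to know `λ(X) = λ(G)`: then both sides of the defect identity vanish at every Kan⁺-layer for `Ω`
  suffices hMC : Literature.NumberTheory.EllipticCurves.lambdaInvariant 2 D.X =
      Summit.BirchSwinnertonDyer.Rank1Residual.X1.MuLambda.lam G by
    obtain ⟨n₀, hn₀⟩ := han W hcm hr hss ha hΔ M g ι Ω hodd hnew hcmg ha2 hΩ hcong f hf S₀ hS2 hSW hSM
    refine ⟨n₀, fun n hn he ↦ ?_⟩
    rw [hn₀ n hn he, hMC, sub_self, sub_self]
  -- Kato's half
  have hle : Literature.NumberTheory.EllipticCurves.lambdaInvariant 2 D.X ≤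
      Summit.BirchSwinnertonDyer.Rank1Residual.X1.MuLambda.lam G :=
    lambdaInvariant_le_lam_of_signedKato hKato W hcm hr hss ha hΔ κ γ hκ hγ hcv f hf ϖ hϖ Lplus Lminus hPP D hX hμ G m hG
  refine le_antisymm hle ?_
  -- the partner's half: a cohomological plus period `Ω'`, the `𝓞`-Pollack pair of `g` at `Ω'`, the norm-λ `d` of `L⁻_g`
  obtain ⟨Ω', hΩ'⟩ := CohomologicalPeriod.exists_isCohomologicalPlusPeriod hnew ι
  obtain ⟨Lp, Lm, hodd', heven'⟩ := stub_pollackCongruencesKAtTwo M g ι Ω' hodd hnew hcmg ha2 hΩ'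
  obtain ⟨hLp0, hLm0⟩ := stub_pollackNonvanishingKAtTwo M g ι Ω' hodd hnew hcmg ha2 hΩ' Lp Lm hodd' heven'
  have hPK : Literature.NumberTheory.EllipticCurves.IsPollackPairK g ι Ω' Lp Lm := ⟨hLp0, hLm0, hodd', heven'⟩
  obtain ⟨d, hd1, hd2⟩ := stub_normLambdaWitnessAtTwo M g ι hnew Lm hLm0
  -- the count of `W` FROM PRINT with `c = 0`: `Sel_{2^∞}(W/ℚ)` finite at analytic rank `0` (GZK), then PUB⁴
  obtain ⟨hC, h412, hcork, -, hWL⟩ := hPubG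
  have hSel : Finite (W.selmerGroupPInfty 2) :=
    Summit.BirchSwinnertonDyer.BirchSwinnertonDyer.Theorems.finite_selmerGroupPInfty_two_of_analyticRank_eq_zero W hGZK hr
  have h1 := Summit.BirchSwinnertonDyer.BirchSwinnertonDyer.Theorems.SignedTransportAtTwo.rlf2_of_print4 hC h412 hcork hWL
    κ γ hκ hγ S₀ hS2 W hss ha hΔ hSW hSel D hX hμ
  -- (R≥) at `Ω'`
  have h2 := hRge W hcm hr hss ha hΔ M g ι Ω' hodd hnew hcmg ha2 hΩ' hcong κ γ hκ hγ hcv S₀ hS2 hSW hSM D hX hμ Lp Lm d hPK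
    hd1 hd2
  have h3 := (Nat.pow_le_pow_iff_right (by norm_num : 1 < 2)).mp (le_trans h2 (le_of_eq h1))
  have hS' : ∀ v ∈ S₀, Rat.HeightOneSpectrum.natGenerator v ≠ 2 := fun v hv ↦
    Summit.BirchSwinnertonDyer.Rank1Residual.X2.EulerFactorInvariants.natGenerator_ne_of_natCast_not_mem v (hS2 v hv)
  rw [Literature.NumberTheory.EllipticCurves.sum_dMultiplicity_two_eq_sum_matsunoLocalTermAtTwo W S₀ hS'] at h3
  -- Kan⁺ at `Ω'` and the two landed layer laws at a common large even layer
  obtain ⟨n₁, hn₁⟩ := han W hcm hr hss ha hΔ M g ι Ω' hodd hnew hcmg ha2 hΩ'.isPlusPeriod hcong f hf S₀ hS2 hSW hSM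
  obtain ⟨n₂, hn₂⟩ := stub_analyticLayerLawKAtTwo M g ι Ω' hnew Lp Lm d hPK hd1 hd2 S₀ hS2
  obtain ⟨n₃, hn₃⟩ := stub_analyticLayerLawAtTwo W hcm hr hss ha hΔ M g ι Ω hodd hnew hcmg ha2 hΩ hcong κ γ hκ hγ hcv f hf ϖ hϖ
    Lplus Lminus hPP S₀ hS2 hSW hSM D G m hG
  have e1 := hn₁ (2 * max n₁ (max n₂ n₃)) (by omega) (even_two_mul _)
  have e2 := hn₂ (2 * max n₁ (max n₂ n₃)) (by omega) (even_two_mul _)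
  have e3 := hn₃ (2 * max n₁ (max n₂ n₃)) (by omega) (even_two_mul _)
  rw [e1, e2] at e3
  omega

/-- **RTC≥ (item 25435) BY NAME from PUB-G, GZK and the pure residual lower bound (R≥).** Under RTC≥'s premise `P(c)` at
`W` the count is `2^(λ(X) + Σ_W + c)`; the print road (GZK + PUB⁴, `c = 0`) gives `2^(λ(X) + Σ_W)`; so `c = 0`, and the claim is
(R≥) verbatim. [cite: GreenbergVatsal2000, Prop. 2.8 and (10)] [cite: GreenbergLNM1716, Props. 4.12–4.15] -/
theorem residualThetaCountLowerAtTwo_of_residualLower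
    (hPubG : Summit.BirchSwinnertonDyer.BirchSwinnertonDyer.Theses.ResidualThetaTransportAtTwo.PublishedInputsGreenbergControlAtTwo)
    (hGZK : Summit.BirchSwinnertonDyer.BirchSwinnertonDyer.Theses.ResidualThetaTransportAtTwo.RankEqAnalyticRankLeOne)
    (hRge : ∀ (W : WeierstrassCurve ℚ) [W.IsElliptic] [W.IsGloballyMinimal], ¬ W.HasCM → W.analyticRank = 0 → Literature.NumberTheory.EllipticCurves.Rank1Residual.GoodSS W 2 → W.frobeniusTrace 2 = 0 → W.Δ < 0 → ∀ (M : ℕ) [NeZero M] (g : CuspForm (CongruenceSubgroup.Gamma0 M) 2) (ι : Literature.NumberTheory.EllipticCurves.ModularForms.coeffField g →+* PadicAlgCl 2) (Ω : ℂ), Odd M → Literature.NumberTheory.EllipticCurves.ModularForms.IsNewform0 g → Literature.NumberTheory.Automorphic.IsCMForm (Literature.NumberTheory.EllipticCurves.ModularForms.liftToGamma1 M 2 g) → Literature.NumberTheory.EllipticCurves.ModularForms.cuspCoeff g 2 = 0 → Literature.NumberTheory.EllipticCurves.IsCohomologicalPlusPeriod g ι Ω → (∀ ℓ : ℕ, ℓ.Prime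 → ¬ ℓ ∣ 2 * M * W.conductorNorm ℤ → ‖Literature.NumberTheory.EllipticCurves.embCoeff g ι ℓ - (W.frobeniusTrace ℓ : PadicAlgCl 2)‖ < 1) → ∀ (κ : Literature.NumberTheory.EllipticCurves.ZpExtension ℚ 2) (γ : Field.absoluteGaloisGroup ℚ), κ.IsCyclotomic → κ.IsTopGenerator γ → Literature.NumberTheory.EllipticCurves.IsCyclotomicVariable 2 γ → ∀ (S₀ : Finset (IsDedekindDomain.HeightOneSpectrum (NumberField.RingOfIntegers ℚ))), (∀ v ∈ S₀, ((2 : ℕ) : NumberField.RingOfIntegers ℚ) ∉ v.asIdeal) → (∀ v : IsDedekindDomain.HeightOneSpectrum (NumberField.RingOfIntegers ℚ), ¬ W.HasGoodReductionAt v → v ∈ S₀) → (∀ v : IsDedekindDomain.HeightOneSpectrum (NumberField.RingOfIntegers ℚ), Rat.HeightOneSpectrum.natGenerator v ∣ M → v ∈ S₀) → ∀ (D : Literature.NumberTheory.EllipticCurves.Kobayashi2003.SignedSelmerDualData W κ γ 1) [Module.Finite (Literature.NumberTheory.EllipticCurves.IwasawaAlgebra 2) D.X], Module.IsTorsion (Literature.NumberTheory.EllipticCurves.IwasawaAlgebra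 2) D.X → D.mu = 0 → ∀ (Lp Lm : Literature.NumberTheory.EllipticCurves.IwasawaAlgebraO (Set.range ι)) (d : ℕ), Literature.NumberTheory.EllipticCurves.IsPollackPairK g ι Ω Lp Lm → (∀ k : ℕ, ‖PowerSeries.coeff k (Literature.NumberTheory.EllipticCurves.iwasawaOToPowerSeries (Set.range ι) Lm)‖ ≤ ‖PowerSeries.coeff d (Literature.NumberTheory.EllipticCurves.iwasawaOToPowerSeries (Set.range ι) Lm)‖) → (∀ k : ℕ, k < d → ‖PowerSeries.coeff k (Literature.NumberTheory.EllipticCurves.iwasawaOToPowerSeries (Set.range ι) Lm)‖ < ‖PowerSeries.coeff d (Literature.NumberTheory.EllipticCurves.iwasawaOToPowerSeries (Set.range ι) Lm)‖) → 2 ^ (d + (∑ v ∈ S₀, 2 ^ padicValNat 2 ((Rat.HeightOneSpectrum.natGenerator v ^ 2 - 1) / 8) * (if Rat.HeightOneSpectrum.natGenerator v ∣ M then (if ‖Literature.NumberTheory.EllipticCurves.embCoeff g ι (Rat.HeightOneSpectrum.natGenerator v) - 1‖ < 1 then 1 else 0) else (if ‖Literature.NumberTheory.EllipticCurves.embCoeff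 g ι (Rat.HeightOneSpectrum.natGenerator v)‖ < 1 then 2 else 0)))) ≤ {x : Literature.NumberTheory.EllipticCurves.subgroupH1 κ.kerSubgroup ↥(AddSubgroup.torsionBy ↥(W.geomPrimaryTorsion 2) (2 : ℤ)) | x ∈ Literature.NumberTheory.EllipticCurves.GreenbergVatsal2000.unramifiedOutside κ.kerSubgroup ↥(AddSubgroup.torsionBy ↥(W.geomPrimaryTorsion 2) (2 : ℤ)) 2 (↑S₀ : Set (IsDedekindDomain.HeightOneSpectrum (NumberField.RingOfIntegers ℚ))) ∧ (∀ (w : NumberField.InfinitePlace ℚ) (σ : Field.absoluteGaloisGroup ℚ), Literature.NumberTheory.EllipticCurves.conjH1 κ.kerSubgroup ↥(AddSubgroup.torsionBy ↥(W.geomPrimaryTorsion 2) (2 : ℤ)) σ x ∈ Literature.NumberTheory.EllipticCurves.GreenbergSelmer.infKer κ.kerSubgroup ↥(AddSubgroup.torsionBy ↥(W.geomPrimaryTorsion 2) (2 : ℤ)) w) ∧ (∀ (v : IsDedekindDomain.HeightOneSpectrum (NumberField.RingOfIntegers ℚ)), ((2 : ℕ) : NumberField.RingOfIntegers ℚ)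 ∈ v.asIdeal → ∀ σ : Field.absoluteGaloisGroup ℚ, W.conjH1 2 κ.kerSubgroup σ (Literature.NumberTheory.EllipticCurves.GreenbergVatsal2000.pushH1 κ.kerSubgroup (AddSubgroup.torsionBy ↥(W.geomPrimaryTorsion 2) (2 : ℤ)).subtype (fun _ _ ↦ rfl) x) ∈ Literature.NumberTheory.EllipticCurves.Kobayashi2003.localKummerOverOfEmb W 2 κ.kerSubgroup (Literature.NumberTheory.EllipticCurves.closureEmb (K := ℚ) (v.adicCompletion ℚ)) (⨆ n : ℕ, Literature.NumberTheory.EllipticCurves.Kobayashi2003.signedLocalPoints κ (v.adicCompletion ℚ) W 1 n))}.ncard) :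
    Summit.BirchSwinnertonDyer.BirchSwinnertonDyer.Theses.ResidualThetaTransportAtTwo.ResidualThetaCountLowerAtTwo := by
  intro W _ _ hcm hr hss ha hΔ M _ g ι Ω hodd hnew hcmg ha2 hΩ hcong κ γ hκ hγ hcv S₀ hS2 hSW hSM D _ hX hμ Lp Lm d hPK hd1 hd2
    c hP
  obtain ⟨hC, h412, hcork, -, hWL⟩ := hPubG
  have hSel : Finite (W.selmerGroupPInfty 2) :=
    Summit.BirchSwinnertonDyer.BirchSwinnertonDyer.Theorems.finite_selmerGroupPInfty_two_of_analyticRank_eq_zero W hGZK hr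
  -- the count of `W`: from print (`c = 0`) and from the premise (`+ c`)
  have h1 := Summit.BirchSwinnertonDyer.BirchSwinnertonDyer.Theorems.SignedTransportAtTwo.rlf2_of_print4 hC h412 hcork hWL
    κ γ hκ hγ S₀ hS2 W hss ha hΔ hSW hSel D hX hμ
  have h1' := hP W hss ha hΔ hSW D hX hμ
  have hc : c = 0 := by
    have h := h1'.symm.trans h1
    have h' := Nat.pow_right_injective (le_refl 2) h
    omega
  subst hc
  simpa only [Nat.add_zero] using
    hRge W hcm hr hss ha hΔ M g ι Ω hodd hnew hcmg ha2 hΩ hcong κ γ hκ hγ hcv S₀ hS2 hSW hSM D hX hμ Lp Lm d hPK hd1 hd2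

/-- **(R≥) from the current pair RLF (item 23110) ∧ RTC≥ (item 25435).** RLF supplies the uniform `c` and its premise
`P(c)`; RTC≥ at that `c` gives `2^(d + Σ_g + c) ≤ #R⁺_{S₀}(W[2])`, a fortiori `2^(d + Σ_g) ≤ #R⁺_{S₀}(W[2])`. So keying the route
on (R≥) loses nothing. [cite: GreenbergVatsal2000, Prop. 2.8 and (10)] -/
theorem residualLower_of_residualLambdaFormula_of_countLower
    (hRLF : Summit.BirchSwinnertonDyer.BirchSwinnertonDyer.Theses.ResidualThetaTransportAtTwo.ResidualLambdaFormulaNegDiscAtTwo)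
    (hLow : Summit.BirchSwinnertonDyer.BirchSwinnertonDyer.Theses.ResidualThetaTransportAtTwo.ResidualThetaCountLowerAtTwo) :
    ∀ (W : WeierstrassCurve ℚ) [W.IsElliptic] [W.IsGloballyMinimal], ¬ W.HasCM → W.analyticRank = 0 → Literature.NumberTheory.EllipticCurves.Rank1Residual.GoodSS W 2 → W.frobeniusTrace 2 = 0 → W.Δ < 0 → ∀ (M : ℕ) [NeZero M] (g : CuspForm (CongruenceSubgroup.Gamma0 M) 2) (ι : Literature.NumberTheory.EllipticCurves.ModularForms.coeffField g →+* PadicAlgCl 2) (Ω : ℂ), Odd M → Literature.NumberTheory.EllipticCurves.ModularForms.IsNewform0 g → Literature.NumberTheory.Automorphic.IsCMForm (Literature.NumberTheory.EllipticCurves.ModularForms.liftToGamma1 M 2 g) → Literature.NumberTheory.EllipticCurves.ModularForms.cuspCoeff g 2 = 0 → Literature.NumberTheory.EllipticCurves.IsCohomologicalPlusPeriod g ι Ω → (∀ ℓ : ℕ, ℓ.Prime → ¬ ℓ ∣ 2 * M * W.conductorNorm ℤ → ‖Literature.NumberTheory.EllipticCurves.embCoeff g ι ℓ - (W.frobeniusTrace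 ℓ : PadicAlgCl 2)‖ < 1) → ∀ (κ : Literature.NumberTheory.EllipticCurves.ZpExtension ℚ 2) (γ : Field.absoluteGaloisGroup ℚ), κ.IsCyclotomic → κ.IsTopGenerator γ → Literature.NumberTheory.EllipticCurves.IsCyclotomicVariable 2 γ → ∀ (S₀ : Finset (IsDedekindDomain.HeightOneSpectrum (NumberField.RingOfIntegers ℚ))), (∀ v ∈ S₀, ((2 : ℕ) : NumberField.RingOfIntegers ℚ) ∉ v.asIdeal) → (∀ v : IsDedekindDomain.HeightOneSpectrum (NumberField.RingOfIntegers ℚ), ¬ W.HasGoodReductionAt v → v ∈ S₀) → (∀ v : IsDedekindDomain.HeightOneSpectrum (NumberField.RingOfIntegers ℚ), Rat.HeightOneSpectrum.natGenerator v ∣ M → v ∈ S₀) → ∀ (D : Literature.NumberTheory.EllipticCurves.Kobayashi2003.SignedSelmerDualData W κ γ 1) [Module.Finite (Literature.NumberTheory.EllipticCurves.IwasawaAlgebra 2) D.X], Module.IsTorsion (Literature.NumberTheory.EllipticCurves.IwasawaAlgebra 2) D.X → D.mu = 0 → ∀ (Lp Lm : Literature.NumberTheory.EllipticCurves.IwasawaAlgebraO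 (Set.range ι)) (d : ℕ), Literature.NumberTheory.EllipticCurves.IsPollackPairK g ι Ω Lp Lm → (∀ k : ℕ, ‖PowerSeries.coeff k (Literature.NumberTheory.EllipticCurves.iwasawaOToPowerSeries (Set.range ι) Lm)‖ ≤ ‖PowerSeries.coeff d (Literature.NumberTheory.EllipticCurves.iwasawaOToPowerSeries (Set.range ι) Lm)‖) → (∀ k : ℕ, k < d → ‖PowerSeries.coeff k (Literature.NumberTheory.EllipticCurves.iwasawaOToPowerSeries (Set.range ι) Lm)‖ < ‖PowerSeries.coeff d (Literature.NumberTheory.EllipticCurves.iwasawaOToPowerSeries (Set.range ι) Lm)‖) → 2 ^ (d + (∑ v ∈ S₀, 2 ^ padicValNat 2 ((Rat.HeightOneSpectrum.natGenerator v ^ 2 - 1) / 8) * (if Rat.HeightOneSpectrum.natGenerator v ∣ M then (if ‖Literature.NumberTheory.EllipticCurves.embCoeff g ι (Rat.HeightOneSpectrum.natGenerator v) - 1‖ < 1 then 1 else 0) else (if ‖Literature.NumberTheory.EllipticCurves.embCoeff g ι (Rat.HeightOneSpectrum.natGenerator v)‖ < 1 then 2 else 0)))) ≤ {x : Literature.NumberTheory.EllipticCurves.subgroupH1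 κ.kerSubgroup ↥(AddSubgroup.torsionBy ↥(W.geomPrimaryTorsion 2) (2 : ℤ)) | x ∈ Literature.NumberTheory.EllipticCurves.GreenbergVatsal2000.unramifiedOutside κ.kerSubgroup ↥(AddSubgroup.torsionBy ↥(W.geomPrimaryTorsion 2) (2 : ℤ)) 2 (↑S₀ : Set (IsDedekindDomain.HeightOneSpectrum (NumberField.RingOfIntegers ℚ))) ∧ (∀ (w : NumberField.InfinitePlace ℚ) (σ : Field.absoluteGaloisGroup ℚ), Literature.NumberTheory.EllipticCurves.conjH1 κ.kerSubgroup ↥(AddSubgroup.torsionBy ↥(W.geomPrimaryTorsion 2) (2 : ℤ)) σ x ∈ Literature.NumberTheory.EllipticCurves.GreenbergSelmer.infKer κ.kerSubgroup ↥(AddSubgroup.torsionBy ↥(W.geomPrimaryTorsion 2) (2 : ℤ)) w) ∧ (∀ (v : IsDedekindDomain.HeightOneSpectrum (NumberField.RingOfIntegers ℚ)), ((2 : ℕ) : NumberField.RingOfIntegers ℚ) ∈ v.asIdeal → ∀ σ : Field.absoluteGaloisGroup ℚ, W.conjH1 2 κ.kerSubgroup σ (Literature.NumberTheory.EllipticCurves.GreenbergVatsal2000.pushH1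 κ.kerSubgroup (AddSubgroup.torsionBy ↥(W.geomPrimaryTorsion 2) (2 : ℤ)).subtype (fun _ _ ↦ rfl) x) ∈ Literature.NumberTheory.EllipticCurves.Kobayashi2003.localKummerOverOfEmb W 2 κ.kerSubgroup (Literature.NumberTheory.EllipticCurves.closureEmb (K := ℚ) (v.adicCompletion ℚ)) (⨆ n : ℕ, Literature.NumberTheory.EllipticCurves.Kobayashi2003.signedLocalPoints κ (v.adicCompletion ℚ) W 1 n))}.ncard := by
  intro W _ _ hcm hr hss ha hΔ M _ g ι Ω hodd hnew hcmg ha2 hΩ hcong κ γ hκ hγ hcv S₀ hS2 hSW hSM D _ hX hμ Lp Lm d hPK hd1 hd2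
  obtain ⟨c, hc⟩ := hRLF κ γ hκ hγ S₀ hS2
  have h2 := hLow W hcm hr hss ha hΔ M g ι Ω hodd hnew hcmg ha2 hΩ hcong κ γ hκ hγ hcv S₀ hS2 hSW hSM D hX hμ Lp Lm d hPK
    hd1 hd2 c (fun E _ _ hssE haE hΔE hSE D' _ hXE hμE ↦ hc E hssE haE hΔE hSE D' hXE hμE)
  exact le_trans (Nat.pow_le_pow_right (by norm_num) (Nat.le_add_right _ c)) h2

end Summit.BirchSwinnertonDyer.BirchSwinnertonDyer.Theorems.ResidualThetaLayer
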